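import Summits.BirchSwinnertonDyer.BirchSwinnertonDyer.Theorems.SignedLowerHalvesSmallImageLowerHalfBothSignsRttD2SeqJ3Exact
import Summits.BirchSwinnertonDyer.BirchSwinnertonDyer.Theorems.SignedLowerHalvesSmallImageLowerHalfBothSignsRttD2J1CyclotomicCarrier
import Literature.NumberTheory.EllipticCurves.SubgroupH1ClosedSubgroupColimit
import Literature.NumberTheory.EllipticCurves.Kato2004.IwasawaH1ReductionInfty
import HarnessLib

/-!
# Route `SignedLowerHalves`, crux L `SmallImageLowerHalfBothSigns` (stmt-BirchSwinnertonDyer-23599), line `rtt_w3` v14 → v15 — E2, row J3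
# (Galois side, part α): FROM LAYER PAIRINGS ALONG THE LOCAL `ℤ_p`-TOWER TO THE PAIRING `P : B → (E^{ε}_{sat,v})^∨` OF THE JUNCTION SOCKET,
# with its `Λ_𝒪`-laws `hPX`/`hPC` and the reciprocity `hrec` reduced to the layers

WIDTH seat `bsd-line-slh-p3-w3` g22 under LEAD `cruxlead-stmt-BirchSwinnertonDyer-23599` g11 (cell `bsd-ssimc`; KEY 2026-08-30T18:56:57Z «J3 = `j₀ : B →ₗ[Λ_𝒪] DQ.X` +
`Function.Exact j₀ gX`, B := honda's `CycIwasawaCohomologyDataO … 1`»); helper `--supports stmt-BirchSwinnertonDyer-23599`. DEFINITIONS WITH BODIES + THEOREMS; no named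
fact, no instance, no `sorry`. HONEST FRAMING: this is the TOWER BOOKKEEPING of J3 — the inputs of -w3 g21's `exists_junction_exact` (p782881) `P`, `hPX`, `hPC`,
`hrec` are produced from a LAYER-PAIRING SOCKET (`TowerPairing`, below) whose intended inhabitant is the family of local Tate pairings `⟨loc_v b_n, ·⟩_{K_{n,v}}` of
the cyclotomic layers; the local duality itself, the Poitou–Tate annihilator identity `hPT`, E2, crux L, crux M and BSD remain OPEN and are proved for NO curve.

SETTING. `K` a number field, `κ : ZpExtension K p`, a discrete `Γ_K`-module `M` with commuting `𝒪 = padicCoeffIntegers S`-scalars, a place `v` with the local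
action `[DistribMulAction Γ_{K_v} M]` (pinned by `hres` in the consumers), `U_n := Gal(K̄_v/K_n·K_v) = localSubgroupOfEmb (κ.layerSubgroup n) ι`,
`U_∞ := Gal(K̄_v/K_∞·K_v) = localSubgroupOfEmb κ.kerSubgroup ι` (`ι = closureEmb K_v`), a local element `γ_v ∈ Γ_{K_v}`, and honda g23's PINNED one-variable
Iwasawa-cohomology datum `I : SmallImageRttD2J1.CycIwasawaCohomologyDataO S κ γ_B θ′ P 1` (p782087: `B := I.H` with `T ↦ conj_{γ_B} − 1`, `C c ↦ H¹(c ⊗ id)`).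
* §1 the local layer groups: normality, antitonicity, openness/closedness, `⋂ₙ U_n = U_∞`, cofinality (compactness of `Γ_{K_v}`), and the EXHAUSTION
  `H¹(U_∞, M) = ⋃ₙ res_n H¹(U_n, M)` with its injectivity half (the tree's `SubgroupH1Colimit`, Serre I §2.2 Prop. 8).
* §2 ★ the socket `TowerPairing S M γ_v I`: additive pairings `pairL n : I.H → Hom(H¹(U_n, M), ℚ/ℤ)` COMPATIBLE WITH RESTRICTION (`pairL m b (res c) = pairL n b c`,
  the projection formula `⟨cor b′, c⟩ = ⟨b′, res c⟩` read on a cores-compatible family), with the CONJUGATION LAW `pairL n (X•b) c = pairL n b (conj_{γ_v} c) − pairL n b c`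
  (Galois-invariance of the local pairing + honda's pin (P5); this FORCES `κ(γ_B) = −κ(res_ι γ_v)`, the involution `ι` of Kato §17 — see the docstring) and the
  `𝒪`-BALANCE `pairL n (C a • b) c = pairL n b (a • c)` (pin (P7) + `𝒪`-bilinearity).
* §3 ★★ `TowerPairing.pairInf : I.H →+ Hom(H¹(U_∞, M), ℚ/ℤ)` — the pairing with the TOP local cohomology, `pairInf b (res_n c) = pairL n b c` (well defined by §1),
  `pairInf_X_smul`, `pairInf_C_smul`.
* §4 ★★★ `TowerPairing.pairing : I.H →+ Hom(E^{ε}_{sat,v}, ℚ/ℤ)` (restriction of `pairInf` to the saturated transported local condition group) with EXACTLY the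
  laws `hPX` / `hPC` of `exists_junction_exact` (`pairing_X_smul`, `pairing_C_smul`), and ★★ `pairing_locSat_eq_zero`: the reciprocity `hrec` from its LAYERWISE form
  `pairL n b (loc_{v,n} c) = 0` for `c ∈ Sel^{ε,S₀}_𝒪(K_n, M)` (the sum formula of Poitou–Tate at the layer `K_n` — NOT proved here).
What is NOT here: the instantiation of the socket (cup product with `T*/p^k = 𝒪 ⊗ μ_{p^k} ⊗ θ′` and the local invariant maps over `K_{n,v}`; part β) and `hPT`.
References: [Kobayashi2003] Thm. 7.3 i); [Rubin2000] Thm. 1.7.3, §4.2; [NeukirchSchmidtWingberg2008] I §5 Prop. 1.5.3 (iv), (7.2.6); [SerreGaloisCohomology1997] I §2.2 Prop. 8;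
[Kato2004Asterisque] §17.13; [PerrinRiou1994Invent] §3.6.1.
-/

set_option autoImplicit false
set_option linter.dupNamespace false -- D-0017: single-problem summit, the namespace repeats the problem name by design
noncomputable section

open scoped Classical
open NumberField IsDedekindDomain Field

namespace Summit.BirchSwinnertonDyer.BirchSwinnertonDyer.Theorems.SmallImageRttD2Seq

open Literature.NumberTheory.EllipticCurves Literature.NumberTheory.EllipticCurves.Kobayashi2003
  Literature.NumberTheory.EllipticCurves.GreenbergVatsal2000 Literature.NumberTheory.GaloisRepresentations
  Summit.BirchSwinnertonDyer.BirchSwinnertonDyer.Theorems.SmallImageCharSignedSelmer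
  Summit.BirchSwinnertonDyer.BirchSwinnertonDyer.Theorems.SmallImageRttD2J1

/-! ## §1. The local layer groups `U_n ≥ U_∞` inside `Γ_{K_v}`: topology and the exhaustion of `H¹(U_∞, M)` -/

section Layers

variable {K : Type} [Field K] [NumberField K] {p : ℕ} [Fact p.Prime] (κ : ZpExtension K p) (v : HeightOneSpectrum (𝓞 K))

/-- `U_n = Gal(K̄_v/K_n·K_v)` is normal in `Γ_{K_v}` (preimage of the normal subgroup `Gal(K̄/K_n)`). [cite: SerreGaloisCohomology1997, II §1.1] -/
theorem normal_localSubgroupOfEmb_layerSubgroup (n : ℕ) :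
    (localSubgroupOfEmb (κ.layerSubgroup n) (closureEmb (K := K) (v.adicCompletion K))).Normal :=
  Subgroup.normal_comap _

/-- `n ↦ U_n` is antitone (`K_n ⊆ K_m` for `n ≤ m`). [cite: SerreGaloisCohomology1997, I §2.2] -/
theorem localSubgroupOfEmb_layerSubgroup_antitone :
    Antitone fun n : ℕ ↦ localSubgroupOfEmb (κ.layerSubgroup n) (closureEmb (K := K) (v.adicCompletion K)) :=
  fun _ _ h _ hτ ↦ κ.layerSubgroup_antitone h hτ

/-- `U_n` is open in `Γ_{K_v}` (continuous preimage of the open `Gal(K̄/K_n)`). [cite: SerreGaloisCohomology1997, I §2.2] -/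
theorem isOpen_localSubgroupOfEmb_layerSubgroup (n : ℕ) :
    IsOpen (localSubgroupOfEmb (κ.layerSubgroup n) (closureEmb (K := K) (v.adicCompletion K)) : Set (absoluteGaloisGroup (v.adicCompletion K))) :=
  (κ.isOpen_layerSubgroup n).preimage (map_continuous (resGalOfEmb (closureEmb (K := K) (v.adicCompletion K))))

/-- `U_∞` is closed in `Γ_{K_v}` (continuous preimage of the closed `Gal(K̄/K_∞)`). [cite: SerreGaloisCohomology1997, I §2.2] -/
theorem isClosed_localSubgroupOfEmb_kerSubgroup :
    IsClosed (localSubgroupOfEmb κ.kerSubgroup (closureEmb (K := K) (v.adicCompletion K)) : Set (absoluteGaloisGroup (v.adicCompletion K))) :=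
  κ.isClosed_kerSubgroup.preimage (map_continuous (resGalOfEmb (closureEmb (K := K) (v.adicCompletion K))))

/-- `⋂ₙ U_n ⊆ U_∞` (`⋂ₙ pⁿℤ_p = 0`). [cite: SerreGaloisCohomology1997, I §2.2] -/
theorem mem_localSubgroupOfEmb_kerSubgroup_of_forall (g : absoluteGaloisGroup (v.adicCompletion K))
    (hg : ∀ n : ℕ, g ∈ localSubgroupOfEmb (κ.layerSubgroup n) (closureEmb (K := K) (v.adicCompletion K))) :
    g ∈ (localSubgroupOfEmb κ.kerSubgroup (closureEmb (K := K) (v.adicCompletion K)) : Set (absoluteGaloisGroup (v.adicCompletion K))) :=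
  κ.mem_kerSubgroup_of_forall_mem_layerSubgroup fun n ↦ hg n

/-- **Cofinality**: every open `W ⊇ U_∞` contains some `U_n` (compactness of `Γ_{K_v}`; the tree's `SubgroupH1Colimit.exists_coe_subset_of_antitone`).
[cite: SerreGaloisCohomology1997, I §2.2 Prop. 8] -/
theorem exists_localSubgroupOfEmb_layerSubgroup_subset (W : Set (absoluteGaloisGroup (v.adicCompletion K))) (hW : IsOpen W)
    (hUW : (localSubgroupOfEmb κ.kerSubgroup (closureEmb (K := K) (v.adicCompletion K)) : Set (absoluteGaloisGroup (v.adicCompletion K))) ⊆ W) :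
    ∃ n : ℕ, (localSubgroupOfEmb (κ.layerSubgroup n) (closureEmb (K := K) (v.adicCompletion K)) : Set (absoluteGaloisGroup (v.adicCompletion K))) ⊆ W := by
  haveI : CompactSpace (absoluteGaloisGroup (v.adicCompletion K)) := absoluteGaloisGroup_compactSpace _
  exact SubgroupH1Colimit.exists_coe_subset_of_antitone _ (isOpen_localSubgroupOfEmb_layerSubgroup κ v)
    (localSubgroupOfEmb_layerSubgroup_antitone κ v) (mem_localSubgroupOfEmb_kerSubgroup_of_forall κ v) hW hUW

variable (M : Type) [AddCommGroup M] [TopologicalSpace M] [DiscreteTopology M] [DistribMulAction (absoluteGaloisGroup (v.adicCompletion K)) M]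

variable {κ v M} in
/-- **Exhaustion (surjectivity half)**: every class of `H¹(U_∞, M)` is `res_n` of a class of some layer `H¹(U_n, M)`, for `M` with open stabilisers in `Γ_{K_v}`.
[cite: SerreGaloisCohomology1997, I §2.2 Prop. 8] -/
theorem exists_resOfLe_layer_eq (hstab : ∀ m : M, IsOpen (MulAction.stabilizer (absoluteGaloisGroup (v.adicCompletion K)) m : Set (absoluteGaloisGroup (v.adicCompletion K))))
    (x : subgroupH1 (localSubgroupOfEmb κ.kerSubgroup (closureEmb (K := K) (v.adicCompletion K))) M) :
    ∃ (n : ℕ) (c : subgroupH1 (localSubgroupOfEmb (κ.layerSubgroup n) (closureEmb (K := K) (v.adicCompletion K))) M),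
      resOfLe M (localSubgroupOfEmb_kerSubgroup_le κ v n) c = x := by
  haveI : CompactSpace (absoluteGaloisGroup (v.adicCompletion K)) := absoluteGaloisGroup_compactSpace _
  obtain ⟨n, c, hc⟩ := SubgroupH1Colimit.exists_mem_range_resOfLe hstab (isClosed_localSubgroupOfEmb_kerSubgroup κ v)
    (fun n ↦ localSubgroupOfEmb (κ.layerSubgroup n) (closureEmb (K := K) (v.adicCompletion K))) (localSubgroupOfEmb_kerSubgroup_le κ v)
    (exists_localSubgroupOfEmb_layerSubgroup_subset κ v) x
  exact ⟨n, c, hc⟩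

variable {κ v M} in
/-- **Exhaustion (injectivity half)**: two layer classes with the same restriction to `U_∞` agree on a deeper layer. [cite: SerreGaloisCohomology1997, I §2.2 Prop. 8] -/
theorem exists_resOfLe_layer_eq_resOfLe_layer
    (hstab : ∀ m : M, IsOpen (MulAction.stabilizer (absoluteGaloisGroup (v.adicCompletion K)) m : Set (absoluteGaloisGroup (v.adicCompletion K))))
    {n n' : ℕ} (c : subgroupH1 (localSubgroupOfEmb (κ.layerSubgroup n) (closureEmb (K := K) (v.adicCompletion K))) M)
    (c' : subgroupH1 (localSubgroupOfEmb (κ.layerSubgroup n') (closureEmb (K := K) (v.adicCompletion K))) M)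
    (h : resOfLe M (localSubgroupOfEmb_kerSubgroup_le κ v n) c = resOfLe M (localSubgroupOfEmb_kerSubgroup_le κ v n') c') :
    ∃ (N : ℕ) (hn : n ≤ N) (hn' : n' ≤ N),
      resOfLe M (localSubgroupOfEmb_layerSubgroup_antitone κ v hn) c = resOfLe M (localSubgroupOfEmb_layerSubgroup_antitone κ v hn') c' :=
  haveI : CompactSpace (absoluteGaloisGroup (v.adicCompletion K)) := absoluteGaloisGroup_compactSpace _
  SubgroupH1Colimit.exists_resOfLe_eq_resOfLe hstab (fun n ↦ localSubgroupOfEmb (κ.layerSubgroup n) (closureEmb (K := K) (v.adicCompletion K)))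
    (isOpen_localSubgroupOfEmb_layerSubgroup κ v) (localSubgroupOfEmb_kerSubgroup_le κ v) (localSubgroupOfEmb_layerSubgroup_antitone κ v)
    (exists_localSubgroupOfEmb_layerSubgroup_subset κ v) c c' h

end Layers

/-! ## §2. The layer-pairing socket -/

section Socket

variable {K : Type} [Field K] [NumberField K] {p : ℕ} [Fact p.Prime] {κ : ZpExtension K p} (S : Set (PadicAlgCl p))
  (M : Type) [AddCommGroup M] [TopologicalSpace M] [DiscreteTopology M] [Module (padicCoeffIntegers S) M]
  {v : HeightOneSpectrum (𝓞 K)} [DistribMulAction (absoluteGaloisGroup (v.adicCompletion K)) M]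
  [SMulCommClass (absoluteGaloisGroup (v.adicCompletion K)) (padicCoeffIntegers S) M]
  (γv : absoluteGaloisGroup (v.adicCompletion K))
  {γB : absoluteGaloisGroup K} {θ' : absoluteGaloisGroup K →ₜ* (padicCoeffIntegers S)ˣ} {P : Set (HeightOneSpectrum (𝓞 K))}
  (I : CycIwasawaCohomologyDataO S κ γB θ' P 1)

/-- ★ **The layer-pairing socket of J3.** For honda's pinned Iwasawa-cohomology datum `I` (`B = I.H = 𝐇¹_P(K_∞/K, 𝒪(θ′)(1))`, `T ↦ conj_{γ_B} − 1`) and the local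
tower `U_n = Gal(K̄_v/K_n·K_v)` of a place `v`: additive pairings `pairL n : B → Hom(H¹(U_n, M), ℚ/ℤ)` (intended: `b ↦ (c ↦ ⟨loc_v b_{n,k}, c̃⟩_{K_{n,v}})`, the local
Tate pairing of the layer `K_{n,v}` of the level-`n` component of `b` with a lift `c̃` of `c` to `M[p^k]`-coefficients, `k ≫ 0`), subject to
(i) COMPATIBILITY WITH RESTRICTION `pairL m b (res^{n}_{m} c) = pairL n b c` (`n ≤ m`; the projection formula `⟨cor y, c⟩_n = ⟨y, res c⟩_m` for the cores-compatible
family `(b_n)`), (ii) the CONJUGATION LAW `pairL n (X • b) c = pairL n b (conj_{γ_v} c) − pairL n b c` — by honda's pin (P5) `proj(X•b) = conj_{γ_B}(proj b) − proj b` and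
the Galois-INVARIANCE `⟨conj_g y, conj_g c⟩ = ⟨y, c⟩` of the local pairing this is the statement `conj_{γ_B} = conj_{γ_v⁻¹}` on the local layers, i.e. it PRESUPPOSES
`γ_B · res_ι(γ_v) ∈ Gal(K̄/K_∞)` (`κ(γ_B) = −κ(res_ι γ_v)`: the involution `ι` of Kato §17.13 / Kobayashi Thm. 7.3 under the tree's transpose convention for the duals
`DQ`, `Dψ`), and (iii) the `𝒪`-BALANCE `pairL n (C a • b) c = pairL n b (a • c)` (pin (P7) and `𝒪`-bilinearity of `T*/p^k × M[p^k] → μ_{p^k}`). Nothing is asserted;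
an inhabitant is part β of J3. [cite: Kobayashi2003, Thm. 7.3 i)] [cite: NeukirchSchmidtWingberg2008, I §5 Prop. 1.5.3 (iv), (7.2.6)] [cite: Kato2004Asterisque, §17.13] -/
structure TowerPairing where
  /-- The pairing of `B` with the layer `H¹(U_n, M)`. -/
  pairL : ∀ n : ℕ, I.H →+ (subgroupH1 (localSubgroupOfEmb (κ.layerSubgroup n) (closureEmb (K := K) (v.adicCompletion K))) M →+ AddCircle (1 : ℚ))
  /-- (i) compatibility with the restriction maps of the local tower. -/
  pairL_resOfLe : ∀ {n m : ℕ} (h : n ≤ m) (b : I.H) (c : subgroupH1 (localSubgroupOfEmb (κ.layerSubgroup n) (closureEmb (K := K) (v.adicCompletion K))) M),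
    pairL m b (resOfLe M (localSubgroupOfEmb_layerSubgroup_antitone κ v h) c) = pairL n b c
  /-- (ii) the conjugation law: `X = T` on `B` is adjoint to `conj_{γ_v} − 1` on the layers. -/
  pairL_X_smul : ∀ (n : ℕ) (b : I.H) (c : subgroupH1 (localSubgroupOfEmb (κ.layerSubgroup n) (closureEmb (K := K) (v.adicCompletion K))) M),
    pairL n ((PowerSeries.X : IwasawaAlgebraO S) • b) c =
      pairL n b (haveI := normal_localSubgroupOfEmb_layerSubgroup κ v n
        conjH1 (localSubgroupOfEmb (κ.layerSubgroup n) (closureEmb (K := K) (v.adicCompletion K))) M γv c) - pairL n b c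
  /-- (iii) the `𝒪`-balance: constants `C a` on `B` are adjoint to the scalar `a` on the layers. -/
  pairL_C_smul : ∀ (n : ℕ) (a : padicCoeffIntegers S) (b : I.H) (c : subgroupH1 (localSubgroupOfEmb (κ.layerSubgroup n) (closureEmb (K := K) (v.adicCompletion K))) M),
    pairL n ((PowerSeries.C a : IwasawaAlgebraO S) • b) c =
      pairL n b (GreenbergSelmer.scalarH1 (localSubgroupOfEmb (κ.layerSubgroup n) (closureEmb (K := K) (v.adicCompletion K))) M a c)

end Socket

/-! ## §3. The pairing with the top local cohomology `H¹(U_∞, M)` -/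

namespace TowerPairing

section Inf

variable {K : Type} [Field K] [NumberField K] {p : ℕ} [Fact p.Prime] {κ : ZpExtension K p} {S : Set (PadicAlgCl p)}
  {M : Type} [AddCommGroup M] [TopologicalSpace M] [DiscreteTopology M] [Module (padicCoeffIntegers S) M]
  {v : HeightOneSpectrum (𝓞 K)} [DistribMulAction (absoluteGaloisGroup (v.adicCompletion K)) M]
  [SMulCommClass (absoluteGaloisGroup (v.adicCompletion K)) (padicCoeffIntegers S) M]
  {γv : absoluteGaloisGroup (v.adicCompletion K)}
  {γB : absoluteGaloisGroup K} {θ' : absoluteGaloisGroup K →ₜ* (padicCoeffIntegers S)ˣ} {P : Set (HeightOneSpectrum (𝓞 K))}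
  {I : CycIwasawaCohomologyDataO S κ γB θ' P 1} (𝒯 : TowerPairing S M γv I)
  (hstab : ∀ m : M, IsOpen (MulAction.stabilizer (absoluteGaloisGroup (v.adicCompletion K)) m : Set (absoluteGaloisGroup (v.adicCompletion K))))

/-- A layer carrying a given class of `H¹(U_∞, M)` (a choice, §1 exhaustion). [cite: SerreGaloisCohomology1997, I §2.2 Prop. 8] -/
def repLayer (x : subgroupH1 (localSubgroupOfEmb κ.kerSubgroup (closureEmb (K := K) (v.adicCompletion K))) M) : ℕ :=
  (exists_resOfLe_layer_eq hstab x).choose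

/-- A layer class restricting to the given class of `H¹(U_∞, M)` (a choice). [cite: SerreGaloisCohomology1997, I §2.2 Prop. 8] -/
def repClass (x : subgroupH1 (localSubgroupOfEmb κ.kerSubgroup (closureEmb (K := K) (v.adicCompletion K))) M) :
    subgroupH1 (localSubgroupOfEmb (κ.layerSubgroup (repLayer hstab x)) (closureEmb (K := K) (v.adicCompletion K))) M :=
  (exists_resOfLe_layer_eq hstab x).choose_spec.choose

/-- The chosen layer class restricts to `x`. [cite: SerreGaloisCohomology1997, I §2.2 Prop. 8] -/
theorem resOfLe_repClass (x : subgroupH1 (localSubgroupOfEmb κ.kerSubgroup (closureEmb (K := K) (v.adicCompletion K))) M) :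
    resOfLe M (localSubgroupOfEmb_kerSubgroup_le κ v (repLayer hstab x)) (repClass hstab x) = x :=
  (exists_resOfLe_layer_eq hstab x).choose_spec.choose_spec

/-- The pairing with `H¹(U_∞, M)` as a bare function: pair with the chosen layer representative. [cite: PerrinRiou1994Invent, §3.6.1] -/
def pairInfFun (b : I.H) (x : subgroupH1 (localSubgroupOfEmb κ.kerSubgroup (closureEmb (K := K) (v.adicCompletion K))) M) : AddCircle (1 : ℚ) :=
  𝒯.pairL (repLayer hstab x) b (repClass hstab x)

/-- **Independence of the representative**: `pairInfFun b x = pairL n b c` for EVERY layer class `c` restricting to `x` (injectivity half of the exhaustion + the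
restriction compatibility (i)). [cite: SerreGaloisCohomology1997, I §2.2 Prop. 8] [cite: NeukirchSchmidtWingberg2008, I §5 Prop. 1.5.3 (iv)] -/
theorem pairInfFun_eq (b : I.H) {n : ℕ} (c : subgroupH1 (localSubgroupOfEmb (κ.layerSubgroup n) (closureEmb (K := K) (v.adicCompletion K))) M)
    (x : subgroupH1 (localSubgroupOfEmb κ.kerSubgroup (closureEmb (K := K) (v.adicCompletion K))) M)
    (hx : resOfLe M (localSubgroupOfEmb_kerSubgroup_le κ v n) c = x) :
    𝒯.pairInfFun hstab b x = 𝒯.pairL n b c := by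
  obtain ⟨N, hN, hN', hres⟩ := exists_resOfLe_layer_eq_resOfLe_layer hstab (repClass hstab x) c ((resOfLe_repClass hstab x).trans hx.symm)
  rw [pairInfFun, ← 𝒯.pairL_resOfLe hN b, hres, 𝒯.pairL_resOfLe hN' b]

/-- ★★ **`pairInf : B →+ Hom(H¹(U_∞, M), ℚ/ℤ)`**, the pairing of the Iwasawa cohomology with the TOP local cohomology of the tower (`H¹(K_{∞,ṽ}, M) = lim→ H¹(K_{n,v}, M)`):
on `res_n c` it is `pairL n b c`. [cite: PerrinRiou1994Invent, §3.6.1] [cite: Kobayashi2003, Thm. 7.3 i)] -/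
def pairInf : I.H →+ (subgroupH1 (localSubgroupOfEmb κ.kerSubgroup (closureEmb (K := K) (v.adicCompletion K))) M →+ AddCircle (1 : ℚ)) where
  toFun b :=
    { toFun := 𝒯.pairInfFun hstab b
      map_zero' := by
        rw [𝒯.pairInfFun_eq hstab b (n := 0) 0 0 (map_zero _), map_zero]
      map_add' := fun x y ↦ by
        -- move representatives of `x` and `y` to a common layer `max n m`
        obtain ⟨n, c, hc⟩ := exists_resOfLe_layer_eq hstab x
        obtain ⟨m, d, hd⟩ := exists_resOfLe_layer_eq hstab y
        have hcL : resOfLe M (localSubgroupOfEmb_kerSubgroup_le κ v (max n m))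
            (resOfLe M (localSubgroupOfEmb_layerSubgroup_antitone κ v (le_max_left n m)) c) = x := by
          have h1 := DFunLike.congr_fun (resOfLe_comp_holds (M := M) (localSubgroupOfEmb_kerSubgroup_le κ v (max n m))
            (localSubgroupOfEmb_layerSubgroup_antitone κ v (le_max_left n m))) c
          rw [AddMonoidHom.comp_apply] at h1
          rw [h1]; exact hc
        have hdL : resOfLe M (localSubgroupOfEmb_kerSubgroup_le κ v (max n m))
            (resOfLe M (localSubgroupOfEmb_layerSubgroup_antitone κ v (le_max_right n m)) d) = y := by
          have h1 := DFunLike.congr_fun (resOfLe_comp_holds (M := M) (localSubgroupOfEmb_kerSubgroup_le κ v (max n m))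
            (localSubgroupOfEmb_layerSubgroup_antitone κ v (le_max_right n m))) d
          rw [AddMonoidHom.comp_apply] at h1
          rw [h1]; exact hd
        rw [𝒯.pairInfFun_eq hstab b _ x hcL, 𝒯.pairInfFun_eq hstab b _ y hdL,
          𝒯.pairInfFun_eq hstab b (resOfLe M (localSubgroupOfEmb_layerSubgroup_antitone κ v (le_max_left n m)) c +
              resOfLe M (localSubgroupOfEmb_layerSubgroup_antitone κ v (le_max_right n m)) d) (x + y) (by rw [map_add, hcL, hdL]),
          map_add] }
  map_zero' := by
    ext x
    change 𝒯.pairInfFun hstab 0 x = 0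
    rw [pairInfFun, map_zero, AddMonoidHom.zero_apply]
  map_add' := fun b b' ↦ by
    ext x
    change 𝒯.pairInfFun hstab (b + b') x = 𝒯.pairInfFun hstab b x + 𝒯.pairInfFun hstab b' x
    simp only [pairInfFun, map_add, AddMonoidHom.add_apply]

/-- Unfolding `pairInf` (definitional). [cite: PerrinRiou1994Invent, §3.6.1] -/
theorem pairInf_apply (b : I.H) (x : subgroupH1 (localSubgroupOfEmb κ.kerSubgroup (closureEmb (K := K) (v.adicCompletion K))) M) :
    𝒯.pairInf hstab b x = 𝒯.pairInfFun hstab b x :=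
  rfl

/-- The defining identity of `pairInf` on restricted layer classes. [cite: PerrinRiou1994Invent, §3.6.1] -/
theorem pairInf_apply_resOfLe (b : I.H) (n : ℕ) (c : subgroupH1 (localSubgroupOfEmb (κ.layerSubgroup n) (closureEmb (K := K) (v.adicCompletion K))) M) :
    𝒯.pairInf hstab b (resOfLe M (localSubgroupOfEmb_kerSubgroup_le κ v n) c) = 𝒯.pairL n b c := by
  rw [pairInf_apply]
  exact 𝒯.pairInfFun_eq hstab b c (resOfLe M (localSubgroupOfEmb_kerSubgroup_le κ v n) c) rfl

/-- ★ **The conjugation law on the top**: `pairInf (X • b) x = pairInf b (conj_{γ_v} x) − pairInf b x` (restriction commutes with conjugation, `resOfLe_comp_conjH1`).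
[cite: Kato2004Asterisque, §17.13] [cite: NeukirchSchmidtWingberg2008, I §5] -/
theorem pairInf_X_smul (b : I.H) (x : subgroupH1 (localSubgroupOfEmb κ.kerSubgroup (closureEmb (K := K) (v.adicCompletion K))) M) :
    𝒯.pairInf hstab ((PowerSeries.X : IwasawaAlgebraO S) • b) x =
      𝒯.pairInf hstab b (haveI := normal_localSubgroupOfEmb_kerSubgroup κ v
        conjH1 (localSubgroupOfEmb κ.kerSubgroup (closureEmb (K := K) (v.adicCompletion K))) M γv x) - 𝒯.pairInf hstab b x := by
  haveI := normal_localSubgroupOfEmb_kerSubgroup κ v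
  obtain ⟨n, c, rfl⟩ := exists_resOfLe_layer_eq hstab x
  haveI := normal_localSubgroupOfEmb_layerSubgroup κ v n
  have hcomm := DFunLike.congr_fun (resOfLe_comp_conjH1_holds (M := M) (localSubgroupOfEmb_kerSubgroup_le κ v n) γv) c
  simp only [AddMonoidHom.comp_apply] at hcomm
  rw [pairInf_apply_resOfLe, 𝒯.pairL_X_smul, ← hcomm, pairInf_apply_resOfLe, pairInf_apply_resOfLe]

/-- ★ **The `𝒪`-balance on the top**: `pairInf (C a • b) x = pairInf b (a • x)` (restriction commutes with scalars, `resOfLe_comp_scalarH1`). [cite: Kato2004Asterisque, §17.13] -/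
theorem pairInf_C_smul (a : padicCoeffIntegers S) (b : I.H) (x : subgroupH1 (localSubgroupOfEmb κ.kerSubgroup (closureEmb (K := K) (v.adicCompletion K))) M) :
    𝒯.pairInf hstab ((PowerSeries.C a : IwasawaAlgebraO S) • b) x =
      𝒯.pairInf hstab b (GreenbergSelmer.scalarH1 (localSubgroupOfEmb κ.kerSubgroup (closureEmb (K := K) (v.adicCompletion K))) M a x) := by
  obtain ⟨n, c, rfl⟩ := exists_resOfLe_layer_eq hstab x
  have hcomm := DFunLike.congr_fun (GreenbergSelmer.resOfLe_comp_scalarH1 (M := M) (localSubgroupOfEmb_kerSubgroup_le κ v n) a) c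
  simp only [AddMonoidHom.comp_apply] at hcomm
  rw [pairInf_apply_resOfLe, 𝒯.pairL_C_smul, ← hcomm, pairInf_apply_resOfLe]

end Inf

/-! ## §4. The pairing `P : B → (E^{ε}_{sat,v})^∨` of the junction socket and its laws -/

section Pairing

variable {K : Type} [Field K] [NumberField K] {p : ℕ} [Fact p.Prime] {κ : ZpExtension K p} {S : Set (PadicAlgCl p)}
  {M : Type} [AddCommGroup M] [TopologicalSpace M] [DiscreteTopology M] [Module (padicCoeffIntegers S) M]
  {V : WeierstrassCurve K} {j : V.geomPrimaryTorsion p →+ M} {S₀ : Set (HeightOneSpectrum (𝓞 K))} {ε : ℤˣ}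
  {v : HeightOneSpectrum (𝓞 K)} [DistribMulAction (absoluteGaloisGroup (v.adicCompletion K)) M]
  [SMulCommClass (absoluteGaloisGroup (v.adicCompletion K)) (padicCoeffIntegers S) M]
  {γv : absoluteGaloisGroup (v.adicCompletion K)}
  {γB : absoluteGaloisGroup K} {θ' : absoluteGaloisGroup K →ₜ* (padicCoeffIntegers S)ˣ} {P : Set (HeightOneSpectrum (𝓞 K))}
  {I : CycIwasawaCohomologyDataO S κ γB θ' P 1} (𝒯 : TowerPairing S M γv I)
  (hstab : ∀ m : M, IsOpen (MulAction.stabilizer (absoluteGaloisGroup (v.adicCompletion K)) m : Set (absoluteGaloisGroup (v.adicCompletion K))))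

/-- ★★★ **`P : B →+ Hom(E^{ε}_{sat,v}, ℚ/ℤ)`**, the pairing of the junction socket (`exists_junction_exact`, p782881): `pairInf` restricted to the saturated transported
local condition group `E^{ε}_{sat,v} ≤ H¹(U_∞, M)`. [cite: Kobayashi2003, Thm. 7.3 i)] [cite: Rubin2000, Thm. 1.7.3] -/
def pairing : I.H →+ (localCondInftySat κ M (padicCoeffIntegers S) V j ε v →+ AddCircle (1 : ℚ)) where
  toFun b := (𝒯.pairInf hstab b).comp (localCondInftySat κ M (padicCoeffIntegers S) V j ε v).subtype
  map_zero' := by rw [map_zero, AddMonoidHom.zero_comp]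
  map_add' := fun b b' ↦ by rw [map_add, AddMonoidHom.add_comp]

/-- Unfolding: `P b c = pairInf b c`. [cite: Kobayashi2003, Thm. 7.3 i)] -/
@[simp] theorem pairing_apply (b : I.H) (c : localCondInftySat κ M (padicCoeffIntegers S) V j ε v) :
    𝒯.pairing hstab b c = 𝒯.pairInf hstab b (c : subgroupH1 (localSubgroupOfEmb κ.kerSubgroup (closureEmb (K := K) (v.adicCompletion K))) M) :=
  rfl

/-- `P` on the restriction of a layer class lying in `E^{ε}_{sat,v}`: the layer pairing. [cite: Kobayashi2003, Thm. 7.3 i)] -/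
theorem pairing_apply_resOfLe (b : I.H) (n : ℕ) (c : subgroupH1 (localSubgroupOfEmb (κ.layerSubgroup n) (closureEmb (K := K) (v.adicCompletion K))) M)
    (hc : resOfLe M (localSubgroupOfEmb_kerSubgroup_le κ v n) c ∈ localCondInftySat κ M (padicCoeffIntegers S) V j ε v) :
    𝒯.pairing hstab b ⟨_, hc⟩ = 𝒯.pairL n b c :=
  𝒯.pairInf_apply_resOfLe hstab b n c

/-- ★★ **`hPX` of the junction socket**: `P (X • b) c = P b ((conj_{γ_v} − 1) c)`. [cite: Kato2004Asterisque, §17.13] [cite: Kobayashi2003, Thm. 7.3 i)] -/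
theorem pairing_X_smul (b : I.H) (c : localCondInftySat κ M (padicCoeffIntegers S) V j ε v) :
    𝒯.pairing hstab ((PowerSeries.X : IwasawaAlgebraO S) • b) c = 𝒯.pairing hstab b ((conjLocalSat κ M (padicCoeffIntegers S) V j ε v γv - 1) c) := by
  rw [pairing_apply, pairing_apply, IwasawaDual.End_sub_apply, AddMonoid.End.one_apply, AddSubgroupClass.coe_sub, coe_conjLocalSat_apply, map_sub,
    pairInf_X_smul]

/-- ★★ **`hPC` of the junction socket**: `P (C a • b) c = P b (a • c)`. [cite: Kato2004Asterisque, §17.13] [cite: Kobayashi2003, Thm. 7.3 i)] -/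
theorem pairing_C_smul (a : padicCoeffIntegers S) (b : I.H) (c : localCondInftySat κ M (padicCoeffIntegers S) V j ε v) :
    𝒯.pairing hstab ((PowerSeries.C a : IwasawaAlgebraO S) • b) c = 𝒯.pairing hstab b (scalarLocalSat κ M (padicCoeffIntegers S) V j ε v a c) := by
  rw [pairing_apply, pairing_apply, coe_scalarLocalSat_apply, pairInf_C_smul]

variable [DistribMulAction (absoluteGaloisGroup K) M]
  (hres : ∀ (σ : absoluteGaloisGroup (v.adicCompletion K)) (m : M), σ • m = resGalOfEmb (closureEmb (K := K) (v.adicCompletion K)) σ • m)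
  (hvp : (p : 𝓞 K) ∈ v.asIdeal)

/-- ★★ **`hrec` of the junction socket FROM ITS LAYERWISE FORM**: if at every layer `K_n` the pairing of `b` with the localisation `loc_{v,n} c` of every class
`c ∈ Sel^{ε,S₀}_𝒪(K_n, M)` vanishes (the Poitou–Tate sum formula at `K_n`, the terms away from `v` being killed by the local conditions), then `P b` kills `loc_v(Sel^{ε,S₀}_𝒪(K_∞, M))`
(`Sel_∞ = ⋃ res_n Sel_n` and `loc_v ∘ res_n = res_n ∘ loc_{v,n}`). [cite: Rubin2000, Thm. 1.7.3] [cite: Kobayashi2003, Thm. 7.3 i)] -/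
theorem pairing_locSat_eq_zero
    (hrecL : ∀ (n : ℕ) (b : I.H) (c : subgroupH1 (κ.layerSubgroup n) M), c ∈ signedTransportSelmerLayerSat κ M (padicCoeffIntegers S) V j S₀ ε n →
      𝒯.pairL n b (locH1Layer κ M v hres n c) = 0)
    (b : I.H) (s : signedTransportSelmerInftySat κ M (padicCoeffIntegers S) V j S₀ ε) :
    𝒯.pairing hstab b (locSat κ M (padicCoeffIntegers S) V j S₀ ε v hres hvp s) = 0 := by
  rw [pairing_apply, coe_locSat_apply]
  refine AddSubgroup.iSup_induction (fun n ↦ (signedTransportSelmerLayerSat κ M (padicCoeffIntegers S) V j S₀ ε n).map (resOfLe M (κ.kerSubgroup_le_layerSubgroup n)))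
    (C := fun s ↦ 𝒯.pairInf hstab b (locH1 κ M v hres s) = 0) s.2 ?_ ?_ ?_
  · rintro n s ⟨c, hc, rfl⟩
    have hcomm := DFunLike.congr_fun (resOfLe_comp_locH1Layer κ M v hres n) c
    simp only [AddMonoidHom.comp_apply] at hcomm
    rw [← hcomm, pairInf_apply_resOfLe]
    exact hrecL n b c hc
  · rw [map_zero, map_zero]
  · intro s t hs ht
    rw [map_add, map_add, hs, ht, add_zero]

end Pairing

end TowerPairing

end Summit.BirchSwinnertonDyer.BirchSwinnertonDyer.Theorems.SmallImageRttD2Seq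

end
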